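import Summits.AnomalousDissipation.AnomalousDissipation.Theses.NeutralTaylorWaves
import Literature.Analysis.FunctionSpaces.TorusCalculusProofs

/-!
# Negative lemma for crux `NeutralTaylorWaves.NewtonRealisation` (stmt-AnomalousDissipation-16315):
# the drift-absorption energy bookkeeping needs the mean-zero state

The crux absorbs the drift `c'` of an exact drifting steady state `(W, Q, c')` into the mean,
`u := W − c'e₃` (registered stubs `stub_driftAbsorption` of `Lines/birth.lean` and of the picked
`Lines/Sketch.lean`, identical signatures), and books the energy as `∫‖u‖² = ∫‖W‖² + c'²`; the
composition's energy ceiling `2E + 2 + (C+1)²` rests on this identity.  Kernel-checked here (refuter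
cdisprove, 2026-08-17):

* `driftAbsorption_energy_false_without_zeroMean` — with the hypothesis `HasZeroMean W` DELETED the
  energy clause of the stub is FALSE: `W ≡ e₃` is a smooth divergence-free EXACT drifting steady state
  of the zero force (every `ν`; `Q = 0`, `c' = 1`) and `∫‖e₃ − e₃‖² = 0 ≠ ∫‖e₃‖² + 1 = 2`.
  Any proof of the stub must use `HasZeroMean W` (the cross term `−2c'⟪∫W, e₃⟫`); Galilean energy is
  not free — the same drift degeneracy as the summit's refuted universal energy ceilings
  (stmt-2979, stmt-0204), here harmless because the crux's `w` IS mean zero.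

Helpers are private copies of standard constant-field identities of the torus calculus. [folklore]
-/

set_option linter.dupNamespace false

noncomputable section

namespace Summit.AnomalousDissipation.AnomalousDissipation.Theorems.NewtonRealisation.Negative

open MeasureTheory
open Literature.Analysis.FunctionSpaces Literature.Analysis.FunctionSpaces.Torus

/-- Partial derivatives of a constant field vanish. [folklore] -/
private theorem partialDeriv_const_field' (e : EuclideanSpace ℝ (Fin 3)) (i : Fin 3)
    (x : UnitAddTorus (Fin 3)) :
    Torus.partialDeriv i (fun _ : UnitAddTorus (Fin 3) => e) x = 0 := by
  simp [Torus.partialDeriv, Torus.lineDeriv]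

/-- Constant fields are divergence free. [folklore] -/
private theorem isDivFree_const_field' (e : EuclideanSpace ℝ (Fin 3)) :
    Torus.IsDivFree (fun _ : UnitAddTorus (Fin 3) => e) := by
  intro x
  simp only [Torus.divergence]
  exact Finset.sum_eq_zero fun i _ => by simp [Torus.partialDeriv, Torus.lineDeriv]

/-- Convecting a constant field gives zero. [folklore] -/
private theorem convect_const_right' (w : UnitAddTorus (Fin 3) → EuclideanSpace ℝ (Fin 3))
    (e : EuclideanSpace ℝ (Fin 3)) (x : UnitAddTorus (Fin 3)) :
    Torus.convect w (fun _ : UnitAddTorus (Fin 3) => e) x = 0 := by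
  unfold Torus.convect Torus.fderiv Torus.liftAt
  simp

/-- The Laplacian of a constant field vanishes. [folklore] -/
private theorem laplacian_const_field' (e : EuclideanSpace ℝ (Fin 3)) (x : UnitAddTorus (Fin 3)) :
    Torus.laplacian (fun _ : UnitAddTorus (Fin 3) => e) x = 0 := by
  rw [Torus.laplacian_eq_sum_partialDeriv_partialDeriv (Torus.isSmooth_const e)]
  refine Finset.sum_eq_zero fun i _ => ?_
  have h : Torus.partialDeriv i (fun _ : UnitAddTorus (Fin 3) => e) =
      fun _ => (0 : EuclideanSpace ℝ (Fin 3)) := funext (partialDeriv_const_field' e i)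
  rw [h, partialDeriv_const_field']

/-- The gradient of the zero scalar vanishes. [folklore] -/
private theorem gradient_zero_scalar' (x : UnitAddTorus (Fin 3)) :
    Torus.gradient (fun _ : UnitAddTorus (Fin 3) => (0 : ℝ)) x = 0 := by
  unfold Torus.gradient Torus.liftAt
  simp [_root_.gradient]

/-- **`stub_driftAbsorption` `_false_without_` `HasZeroMean W` (energy clause).** With the mean-zero
hypothesis on the drifting state deleted, the energy identity `∫‖W − c'e₃‖² = ∫‖W‖² + c'²` of the
registered stub fails: witness `W ≡ e₃`, `Q = 0`, `c' = 1`, `f = 0` (an exact drifting steady state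
for every viscosity `ν`), where the left side is `0` and the right side is `2`. -/
theorem driftAbsorption_energy_false_without_zeroMean :
    ¬ (∀ (ν : ℝ) (f W : UnitAddTorus (Fin 3) → EuclideanSpace ℝ (Fin 3)) (Q : UnitAddTorus (Fin 3) → ℝ)
        (c' : ℝ), IsSmooth W → IsSmooth Q → IsDivFree W →
        (∀ x, Torus.convect W W x - ν • Torus.laplacian W x + Torus.gradient Q x -
            c' • Torus.partialDeriv (2 : Fin 3) W x = f x) →
        MeasureTheory.integral MeasureTheory.volume
            (fun x => ‖W x - c' • EuclideanSpace.single (2 : Fin 3) (1 : ℝ)‖ ^ 2) =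
          MeasureTheory.integral MeasureTheory.volume (fun x => ‖W x‖ ^ 2) + c' ^ 2) := by
  intro h
  have key := h 0 (fun _ => 0) (fun _ => EuclideanSpace.single (2 : Fin 3) (1 : ℝ)) (fun _ => 0) 1
    (Torus.isSmooth_const _) (Torus.isSmooth_const _) (isDivFree_const_field' _) (by
      intro x
      simp only [convect_const_right', laplacian_const_field', gradient_zero_scalar',
        partialDeriv_const_field', smul_zero, sub_zero, add_zero])
  simp at key
  norm_num at key

end Summit.AnomalousDissipation.AnomalousDissipation.Theorems.NewtonRealisation.Negative

end
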